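import Summits.QuantumFields.BalabanUV.Beta.SymSliceProjectorKernel

/-!
# `BalabanUV.Beta.SymSliceProjectorSpread` — binder row D1, JSB12SYM-SPINE v1.1 (Σ3) step K1-b part 3: ENTRIES OF AN ORTHOGONAL PROJECTOR ARE
# BOUNDED BY ONE, `symEc` IS SPREAD, and THE BLOCK SUM LEMMA (a lattice `tsum` supported in one block is the finite block sum)

CHART (RULING R-D1-g25-4): chart (II) — fixed κ = 0 slice; hSX separate.
HONEST FRAMING (cell contract, verbatim): «discharging `BetaPertH` makes Bałaban's UV stability UNCONDITIONAL — a real constructive-QFT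
result; it is NOT the continuum limit and NOT the Clay problem.»  THIS MODULE DISCHARGES NOTHING of `BetaPertH` ∕ row D1: [folklore] finite linear
algebra.  0 sorry, 0 `def … : Prop`, nothing cited.  NOT HERE (K1-b part 4 ∕ K2): idempotence and the fixing identities of `symEc` at kernel level,
`permK`∕`refK` covariance, `RelInv`.  NOT D1, NOT BetaPertH, NOT continuum, NOT Clay.
HONEST DEPENDENCY (verbatim): «continuum YM on T⁴ ⇐ BetaPertH ∧ nine spine estimates (0/9 proved); BetaPertH ⇐ (D1) ∧ (D4) ∧ CAP+tail;
G-an2-4 gates asym, D1 and NE2/3/4.»  ABSOLUTE RULE (cell, verbatim): «No internally-minted statement may enter as a cited fact. Every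
hypothesis is either kernel-proved in this package or a verbatim quotation of a PUBLISHED theorem with page reference.»
Unit `b2b-balaban-beta-an2` gen 25 (row-D1 owner), 2026-08-21.
-/

namespace Summit.QuantumFields.BalabanUV.Beta.SymSliceProjectorSpread

noncomputable section

open Finset Matrix
open scoped BigOperators Nat
open Literature.MathematicalPhysics.QuantumFieldTheory
open Literature.MathematicalPhysics.QuantumFieldTheory.Balaban1983to89
open Literature.MathematicalPhysics.QuantumFieldTheory.Balaban1983to89.Beta
open Literature.Probability.LatticeModels (Torus.proj)
open B12Sec2to5 (l1 l1_nonneg)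
open ExpKernelCalculus (MKer Decays l1_sub_symm)
open AffineAveraging (Form0 Form1 Site box toSite)
open AveragingContours (blk off off_mem_box blk_add_off blk_block)
open OneStepResolventKernel (Fib)
open Summit.QuantumFields.BalabanUV.Beta.TameKernelCalculus (Spr)
open Summit.QuantumFields.BalabanUV.Beta.AxialDressingRooted (cube mem_cube l1_le_of_mem_cube)
open Summit.QuantumFields.BalabanUV.Beta.KernelOrthoProjector
open Summit.QuantumFields.BalabanUV.Beta.SymSliceBlockMatrix
open Summit.QuantumFields.BalabanUV.Beta.SymSliceProjectorKernel

/-! ## §1 Entries of a symmetric idempotent real matrix are bounded by one -/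

section Proj

variable {k : Type*} [Fintype k]

/-- [folklore] A symmetric idempotent real matrix has diagonal `P i i = Σ_l (P i l)²`. -/
theorem diag_eq_sum_sq_of_symm_idem {P : Matrix k k ℝ} (hs : Pᵀ = P) (hi : P * P = P) (i : k) : P i i = ∑ l, P i l ^ 2 := by
  have h := congrFun (congrFun hi i) i
  rw [Matrix.mul_apply] at h
  rw [← h]
  refine Finset.sum_congr rfl fun l _ => ?_
  have hl : P l i = P i l := by
    have := congrFun (congrFun hs i) l
    rw [Matrix.transpose_apply] at this
    exact this
  rw [hl, sq]

/-- [folklore] **ENTRIES OF A SYMMETRIC IDEMPOTENT REAL MATRIX ARE BOUNDED BY ONE**: `|P i j| ≤ 1`. -/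
theorem abs_apply_le_one_of_symm_idem {P : Matrix k k ℝ} (hs : Pᵀ = P) (hi : P * P = P) (i j : k) : |P i j| ≤ 1 := by
  have hdi := diag_eq_sum_sq_of_symm_idem hs hi i
  have hij : P i j ^ 2 ≤ ∑ l, P i l ^ 2 :=
    Finset.single_le_sum (f := fun l => P i l ^ 2) (fun l _ => sq_nonneg _) (Finset.mem_univ j)
  have hii : P i i ^ 2 ≤ ∑ l, P i l ^ 2 :=
    Finset.single_le_sum (f := fun l => P i l ^ 2) (fun l _ => sq_nonneg _) (Finset.mem_univ i)
  rw [← hdi] at hij hii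
  have h1 : P i i ≤ 1 := by nlinarith [sq_nonneg (P i i)]
  have h2 : P i j ^ 2 ≤ 1 := hij.trans h1
  rw [← sq_le_one_iff_abs_le_one]
  exact h2

/-- [folklore] **ENTRIES OF THE KERNEL PROJECTOR ARE BOUNDED BY ONE** (`G` of full row rank). -/
theorem abs_kerProj_apply_le_one [DecidableEq k] {m : Type*} [Fintype m] [DecidableEq m] {G : Matrix m k ℝ} (hG : IsUnit (G * Gᵀ).det) (i j : k) : |kerProj G i j| ≤ 1 :=
  abs_apply_le_one_of_symm_idem (kerProj_transpose G) (kerProj_idem hG) i j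

end Proj

/-! ## §2 `symEc` is spread -/

section Spread

variable {d : ℕ}

/-- [folklore] Entries of `Pmat` are bounded by one. -/
theorem abs_Pmat_apply_le_one {N : ℕ} (hN : 1 ≤ N) (i j : BIdx (d + 1) N) : |Pmat N i j| ≤ 1 := by
  rw [Pmat]
  exact abs_kerProj_apply_le_one (m := CIdx (d + 1) N) (isUnit_det_gram_Gmat hN) i j

/-- [folklore] **EVERY ENTRY OF `symEc` IS BOUNDED BY ONE.** -/
theorem abs_symEc_le_one {N : ℕ} (hN : 1 ≤ N) (x x' : Fin (d + 1) → ℤ) (a b : Fib d) : |symEc N x x' a b| ≤ 1 := by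
  rcases a with α | m <;> rcases b with β | m'
  · by_cases h : IsIntBond N α x ∧ IsIntBond N β x'
    · rw [symEc_inl_inl_of_int h.1 h.2]
      split_ifs
      · exact abs_Pmat_apply_le_one hN _ _
      · rw [abs_zero]; exact zero_le_one
    · rw [symEc_inl_inl_of_not_int h]
      split_ifs
      · rw [abs_one]
      · rw [abs_zero]; exact zero_le_one
  · rw [symEc_inl_inr, abs_zero]; exact zero_le_one
  · rw [symEc_inr_inl, abs_zero]; exact zero_le_one
  · rw [symEc_inr_inr]
    split_ifs
    · rw [abs_one]
    · rw [abs_zero]; exact zero_le_one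

/-- [folklore] The decay constant of `symEc` at rate `δ`: `exp(δ(d+1)N)`. -/
def cE (d N : ℕ) (δ : ℝ) : ℝ := Real.exp (δ * (((d : ℝ) + 1) * N))

/-- [folklore] `1 ≤ cE` for `δ ≥ 0`. -/
theorem one_le_cE (d N : ℕ) {δ : ℝ} (hδ : 0 ≤ δ) : 1 ≤ cE d N δ := Real.one_le_exp (by positivity)

/-- [folklore] **`symEc` DECAYS AT EVERY RATE** (bounded entries on the block window, diagonal elsewhere). -/
theorem decays_symEc {N : ℕ} (hN : 1 ≤ N) {δ : ℝ} (hδ : 0 ≤ δ) : Decays (symEc (d := d) N) (cE d N δ) δ := by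
  intro x x' a b
  have hpos : 0 ≤ cE d N δ * Real.exp (-δ * l1 (x - x')) := mul_nonneg (Real.exp_pos _).le (Real.exp_pos _).le
  -- on the block window the weight is at least one
  have hwin : x' - x ∈ cube (d + 1) N → (1 : ℝ) ≤ cE d N δ * Real.exp (-δ * l1 (x - x')) := fun h => by
    have hl : l1 (x - x') ≤ ((d : ℝ) + 1) * N := by
      rw [l1_sub_symm]
      have := l1_le_of_mem_cube h
      push_cast at this
      exact this
    unfold cE
    rw [← Real.exp_add]
    exact Real.one_le_exp (by nlinarith)
  have hdiag : x = x' → (1 : ℝ) ≤ cE d N δ * Real.exp (-δ * l1 (x - x')) := fun h => by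
    apply hwin
    rw [h, sub_self]
    exact AxialDressingRooted.zero_mem_cube N
  rcases a with α | m <;> rcases b with β | m'
  · by_cases hz : symEc N x x' (Sum.inl α) (Sum.inl β) = 0
    · rw [hz, abs_zero]; exact hpos
    · exact (abs_symEc_le_one hN x x' _ _).trans (hwin (symEc_inl_inl_window hN hz))
  · rw [symEc_inl_inr, abs_zero]; exact hpos
  · rw [symEc_inr_inl, abs_zero]; exact hpos
  · rw [symEc_inr_inr]
    split_ifs with h
    · rw [abs_one]; exact hdiag h.1
    · rw [abs_zero]; exact hpos

/-- [folklore] **`symEc` IS SPREAD.** -/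
theorem spr_symEc {N : ℕ} (hN : 1 ≤ N) : Spr (symEc (d := d) N) := ⟨cE d N 1, 1, one_pos, decays_symEc hN zero_le_one⟩

end Spread

/-! ## §3 The block sum lemma -/

section BlockSum

variable {d : ℕ}

/-- [folklore] **A LATTICE SUM SUPPORTED IN ONE BLOCK IS THE FINITE BLOCK SUM**:
`∑' x′, [blk N x′ = y]·h x′ = Σ_{b ∈ box} h (N•y + toSite b)` (`N ≥ 1`). -/
theorem tsum_block {N : ℕ} (hN : 1 ≤ N) (y : Fin (d + 1) → ℤ) (h : (Fin (d + 1) → ℤ) → ℝ) :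
    ∑' x', (if blk N x' = y then h x' else 0) = ∑ b ∈ box (d + 1) N, h ((N : ℤ) • y + toSite b) := by
  classical
  have hinj : Set.InjOn (fun b : Fin (d + 1) → ℕ => (N : ℤ) • y + toSite b) ↑(box (d + 1) N) :=
    fun b _ b' _ hbb => toSite_inj.1 (add_left_cancel hbb)
  rw [tsum_eq_sum (s := (box (d + 1) N).image fun b => (N : ℤ) • y + toSite b)]
  · rw [Finset.sum_image hinj]
    refine Finset.sum_congr rfl fun b hb => ?_
    rw [if_pos (blk_block y hb)]
  · intro x' hx'
    rw [if_neg]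
    intro hblk
    refine hx' (Finset.mem_image.2 ⟨off N x', off_mem_box hN x', ?_⟩)
    have := blk_add_off hN x'
    rw [hblk] at this
    exact this

/-- [folklore] The same with the support condition written `blk N x′ = blk N x`. -/
theorem tsum_block_of {N : ℕ} (hN : 1 ≤ N) (x : Fin (d + 1) → ℤ) (h : (Fin (d + 1) → ℤ) → ℝ) :
    ∑' x', (if blk N x = blk N x' then h x' else 0) = ∑ b ∈ box (d + 1) N, h ((N : ℤ) • blk N x + toSite b) := by
  rw [← tsum_block hN (blk N x) h]
  refine tsum_congr fun x' => ?_
  by_cases hb : blk N x = blk N x'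
  · rw [if_pos hb, if_pos hb.symm]
  · rw [if_neg hb, if_neg (fun h' => hb h'.symm)]

end BlockSum

end

end Summit.QuantumFields.BalabanUV.Beta.SymSliceProjectorSpread
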